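import Summits.QuantumFields.YangMills.Theorems.BalabanUVNodesN12AtRecord13Prop1KnitThm1WindowDirectOfClassOnlyRowL1NearRadiusDatumScaleOfRecord
import Summits.QuantumFields.YangMills.Theorems.BalabanUVNodesN12MinimiserFamilyKnitRowThm1NamedFactsOnZOfRecord
import Literature.MathematicalPhysics.QuantumFieldTheory.Balaban1983to89.B15Prop1MinimiserClassAtDatumScale
import Summits.QuantumFields.YangMills.Theorems.BalabanUVNodesN12Prop1DirectOfClassOnlyRowL1UniformB
import Summits.QuantumFields.YangMills.Theorems.BalabanUVNodesN12Prop1DirectOfClassOnly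

/-!
# BalabanUVNodes ∕ N12 — «12Q-DIRECT v14: THE FOUR LETTER FAMILIES DISCHARGED» OVER THE JUNCTION OF RECORD ✓p748139 (floor-free [15] names): the chart half `hhalf`, the (P4)′ row-preimage
# letter `hHrow`, the small-below letter `hsbU` and the curvature letter `hcurv` — and their nine constants `C ρ Kτ ρτ ρ5 εH B₁ ρ6 M₂` — DISCHARGED BY NAME from the hypothesis-free UNIFORM
# producers, the constants announced ∃-FIRST with the (J0′) thresholds BEFORE `Θ` ([Balaban1989LargeFieldI] (0.2)–(0.6) p.176, (1.74) p.192, Prop. 1 p.194; [Balaban1985Variational] (1)–(8)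
# pp.277–279, (44)–(47) p.285, (83) p.290; [Balaban1989LargeFieldII] (1.12)–(1.13) p.359; [Balaban1988Convergent] (2.2) p.255, (2.10)–(2.13) pp.256–257)

Cell `pub-ymgap` (HUMAN RULINGS D-0062 ∕ D-0149), seat `pub-ymgap-dag-n12-d` g28 (R134 N12 [B15] s2; count-neutral helper of K1⁹ `stmt-QuantumFields-27364`, `--kind proof --supports … --as helper`).
THEOREMS ONLY (0 `def`, 0 `instance`, 0 `sorry`); ONE composition BY NAME (generator `mk_l8.py`, HOME `lean/g28/`; the same surgery as `mk_l7.py` = v14 on K0⁷'s guarded currency).  INTENT-106b.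
WHAT.  The junction of record ✓p748139 `…WindowDirectDatumScaleOfThm1NamedFactsOfRecord` displays, per run `P` and instance `i`, four ANALYTIC LETTER FAMILIES with universally bound constants:
the ρ6b CHART HALF `hhalf` (`C ρ Kτ ρτ ρ5`), the (P4)′ ROW-PREIMAGE∕PROXIES letter `hHrow` (`εH B₁`), the SMALL-BELOW letter `hsbU` and the CURVATURE letter `hcurv` (`ρ6 M₂`).  All four have
HYPOTHESIS-FREE producers in the tree whose constants depend on `(P.K, k P ·)` ALONE: dag-n12-c `N12DirectChartPackageOfClassRowL1Family.exists_hWD_chartHalf_of_class_uniform_rowl1_family`,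
dag-n12-d g21 `N12Prop1DirectOfClassOnlyRowL1UniformB.exists_rowPreimageProxiesLetter_family_uniformB` (over dag-n12-w6 g9's uniform-`B` hull count) and dag-n12-c
`N12Prop1DirectOfClassOnly.exists_curvatureLetters_family`.  THIS FILE = ✓p748139 with those 4 letters + 9 constants + 5 sign rows REMOVED from the display and the constants ANNOUNCED in the
∃-prefix `∃ ρJ εW δ₀ …, ∃ C ρ Kτ ρτ ρ5 εH B₁ ρ6 M₂` (with `0 ≤ C`, `0 < ρ`, `0 ≤ Kτ`, `0 < ρτ`, `0 < ρ5`, `0 < εH`, `0 ≤ B₁`, `0 < ρ6`, `0 ≤ M₂`) BEFORE `Θ` ∕ the class threshold ∕ the data budget —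
every later row that mentions them (the explicit threshold `δ ≤ min(…ρ, ρτ, B₁, M₂, C, Kτ…) (εH)`, the floors `… ≤ ρ5`, `… ≤ ρ6`) is now a smallness condition on announced constants.  Proof =
✓p748139's with three `choose` lines (one producer each, per run) and `hhalf`∕`hHrow`∕`hsbU`∕`hcurv` fed to T4′ from them (`hHrow P i Wd U₀ := hrow P Θ.ν hM2 (Z P) (hdiv P) i Wd U₀`).
REMAINING DISPLAYED PRICE of N12's (J0′)∘direct road after this file: the tower rows `hres hpin hmassLive h180 h189` (K0∕N24 producers), the two floor-free [15] names `h15`∕`h15EU` (K0⁷ OPEN ∕ no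
producer; the K0⁷-GUARDED edition is the sibling `…LettersDischargedOfK0GridGNamedEUOfRecord`), the (J0′) head's U4 threshold rows at the cap, the explicit-threshold window, numerics ∕ geometry ∕
box rows — and NO analytic letter about charts, proxies, curvature or minimisers.
HONEST FRAMING.  Composition BY NAME; every displayed row stays a hypothesis (CONDITIONAL); the producers' constants are not print's numbers (census U4, dag-n12-w6 LOCATED-ε∕B-VALUE); nothing
of Bałaban's asserted; N12 NOT discharged; K0⁷ ∕ K1⁹ OPEN; counts unmoved (28∕28 · 8∕27); one finite 𝕋⁴ programme at fixed `ε = L^{-K}` — R4 closes only the conditional rung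
`BalabanLadder.UV`; nothing continuum ∕ ℝ⁴ ∕ OS; the Yang–Mills mass gap (Clay) is NOT proved by any of this.
-/

noncomputable section
open MeasureTheory Set Finset Metric Filter
open scoped Matrix.Norms.L2Operator BigOperators Matrix RealInnerProductSpace Real InnerProductSpace Topology

namespace Summit.QuantumFields.YangMills.BalabanUVNodes.N12AtRecord13Prop1KnitThm1WindowDirectDatumScaleLettersDischargedOfThm1NamedFactsOfRecord

open Literature.MathematicalPhysics.QuantumFieldTheory.Balaban1983to89
open Literature.MathematicalPhysics.QuantumFieldTheory.Balaban1983to89.T4Continuum (T4Family LStep Letter walk walkEnd netDisp holAt)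
open Literature.MathematicalPhysics.QuantumFieldTheory.Balaban1983to89.DagBinding
open Literature.MathematicalPhysics.QuantumFieldTheory.Balaban1983to89.Node00
open FlowStep (prefixOf BetaLowerH BetaUpperH)
open B15Claim189Assembly (new189 chiPP dom half)
open B15 (Prop1Printed Ineq180)
open B15.BasicStep (Claim189)
open B8Eq17ClassAkV1 (plaqsOf)
open B14.Eq216Concrete (inputs feeds)
open GaugeGroup (dist1)
open GaugeField (plaqHol gaugeAct)
open B15RPrime1100OfRep (rPrimeDataOfSel)
open Summit.QuantumFields.YangMills.BalabanUVNodes.N12AtRecord13OfResiduals (b15Leaf_WOfRecord₁₃_liveRepin₁₃_of_massLive_of_hasResiduals)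
open Summit.QuantumFields.YangMills.BalabanUVNodes.N12AtRecord13Prop1KnitThm1OfRecord (thm1TorusClass_of_variationalThm1RegSepCoP7M)
open T4CubeChartGnomonic (SU2)
open B15Prop1ChartSU2 (su2Chart)
open B15Prop1SliceCoordinates (GaugeSlice ιA)
open T4AxialGaugeSmallField (castSite boxPlaqs boxBonds)
open B6BondElimination (unitVec)
open B6TreeGaugePoincare (curl)
open B16Eq18Proof (box)
open B15Extension193 (extend)
open B15ShellGauge193 (shellGauge)
open B15Sect1Instances (fun177std)
open B14.Eq213DetSet (Bj maxDomT)
open B14.Eq213MaximalDomains (side)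
open B14.Eq22Determines (blockIter IsBlockUnion)
open Literature.MathematicalPhysics.QuantumFieldTheory.BalabanImbrieJaffe1984to88.BIJ85Eq453GaugeField (qsstarGIter0)
open B16Sect1Backgrounds (expMul toMS)
open B15DeterminingSets (pts DetBackground genSet IsMinimizer MSField avgFamily bondsOf DetSet embIter AgreeOn)
open B5Eq118OneStroke (iterBlockOf)
open Literature.MathematicalPhysics.QuantumFieldTheory.Balaban1983to89.Node00 (coeField constrEnum)
open B15Eq112TorusCover (lift)
open ExpMeanLog (deltaSU)
open B15Prop1Carrier (lfVarOn InstOn InstOn.std plaqsInside)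
open Summit.QuantumFields.YangMills.BalabanUVNodes.N12AtRecord13Prop1KnitThm1WindowDirectOfClassOnlyRowL1NearRadiusDatumScaleOfRecord (exists_areg_pinLF_b15Leaf_WOfRecord₁₃_liveRepin₁₃_of_massLive_of_hasResiduals_of_variationalThm1RegSepCoP7M_atZSeqCoPRecord_windowDirectOfClassOnlyRowL1NearRadiusDatumScale)
open Summit.QuantumFields.YangMills.BalabanUVNodes.N12MinimiserFamilyKnitRowThm1NamedFactsOnZOfRecord (exists_R_hMinRow_of_variationalThm1NamedFacts_alongOrbit_onZ_ofRecord)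
open B15Prop1NumericsThresholds (plaqSmallOn_of_le)
open B15Prop1MinimiserClassAtDatumScale (isMinimizer_withEps_base_of_thm1TorusClass isMinimizer_withEps_of_norm_lt)
open Summit.QuantumFields.YangMills.BalabanUVNodes.N12DirectChartPackageOfClassRowL1Family (exists_hWD_chartHalf_of_class_uniform_rowl1_family)
open Summit.QuantumFields.YangMills.BalabanUVNodes.N12Prop1DirectOfClassOnlyRowL1UniformB (exists_rowPreimageProxiesLetter_family_uniformB)
open Summit.QuantumFields.YangMills.BalabanUVNodes.N12Prop1DirectOfClassOnly (exists_curvatureLetters_family)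
open Summit.QuantumFields.YangMills.BalabanUVNodes.N12MinimiserFamilyKnitRowThm1Letters (boxRow3_of_boxRow5)
open Summit.QuantumFields.YangMills.BalabanUVNodes.N12Prop1DirectOfClassOnlyRowL1NearRadiusDatumScaleWindowUniform (exists_domain_prop1Printed_lfVarOn_std_su2_box_intrinsic_analytic_atZSeqCoPRecord_ofThm1TorusClass_ofMinimiserFamily_ofClassOnlyRowL1NearRadiusDatumScale_ofWindowGaugeUniform_explicit)
open T4AdjointCovarianceUnitary (lieSU)
open B15Prop1GradientFromNearValueAtCoPRecord (far_letter_of_box)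
open B15Prop1AnalyticExtClause (cplxVec anExt)
open B15Prop1ChartCalculusSU2 (E3)

variable {F : T4Family}

/-! ## §1 N12's (J0′)∘direct road of record (floor-free [15] names) with the chart-half ∕ (P4)′ ∕ small-below ∕ curvature letter families discharged and their constants announced ∃-first -/


/-- ★★★★★ **«12Q-DIRECT v14» OVER THE JUNCTION OF RECORD — ✓p748139 WITH THE FOUR LETTER FAMILIES `hhalf` ∕ `hHrow` ∕ `hsbU` ∕ `hcurv` DISCHARGED BY NAME AND THEIR NINE CONSTANTS
ANNOUNCED ∃-FIRST**: ∃ thresholds `ρJ εW δ₀` (head ✓p740879 at `ν₀`) and letter constants `C ρ Kτ ρτ ρ5 εH B₁ ρ6 M₂` (uniform producers, functions of `(P.K, k)`) → ∀ `Θ` pinned to `ν₀`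
off `εreg` → T4′'s `Θ`-rows (minus the two letter families) → ∀ guard cap `eG` with the head's rows → ∃ radius `R` → ∀ data budget `eR ≤ eG` with the floor rows (on announced `ρ5`, `ρ6`) →
∀ tolerance `δ` in the window → `∃ areg`, N12's Prop-1 leaf at the live re-pin.  Proof: ✓p748139's, plus `exists_hWD_chartHalf_of_class_uniform_rowl1_family` ∕
`exists_rowPreimageProxiesLetter_family_uniformB` ∕ `exists_curvatureLetters_family` per run.  Count-neutral; CONDITIONAL; NOT a discharge of N12.
[cite: Balaban1989LargeFieldI, (0.2)–(0.6) p.176, (1.74) p.192, p.193 ll.14–20, Prop. 1 (1.77)–(1.78) p.194; Balaban1985Variational, (1) p.277, (2)–(7) p.278, Thm 1 (8) p.279, (44)–(47) p.285, (83) p.290, Sect. G pp.305–307; Balaban1989LargeFieldII, (1.7)–(1.9) p.358, (1.12)–(1.13) p.359; Balaban1988Convergent, (2.2) p.255, (2.10)–(2.13) pp.256–257] -/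
theorem exists_constants_thresholds_radius_areg_pinLF_b15Leaf_WOfRecord₁₃_liveRepin₁₃_windowDirectDatumScale_lettersDischarged_ofThm1NamedFacts
    (hd3 : ∀ P : B12.RunParams, 3 ≤ (F.P P.K).d)
    (h0 : ∀ P : B12.RunParams, 0 < (F.P P.K).d)
    (ι : B12.RunParams → Type)
    {B₃ a₀ a₁' : ℝ}
    (Z Λ : ∀ P : B12.RunParams, ι P → Set (Site (F.P P.K) 0))
    (k : ∀ P : B12.RunParams, ι P → ℕ)
    (M : ∀ P : B12.RunParams, ι P → ℝ)
    (hk0 : ∀ (P : B12.RunParams) (i : ι P), 0 < k P i)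
    (hk1 : ∀ (P : B12.RunParams) (i : ι P), k P i + 1 ≤ (F.P P.K).m + (F.P P.K).K)
    (T : ∀ (P : B12.RunParams) (i : ι P), Finset (PBond (F.P P.K) (k P i)))
    (lo hi : ∀ P : B12.RunParams, ι P → Fin (F.P P.K).d → ℤ)
    (n : ∀ P : B12.RunParams, ι P → ℕ)
    (hn : ∀ (P : B12.RunParams) (i : ι P) κ, hi P i κ ≤ lo P i κ + n P i)
    (hN : ∀ (P : B12.RunParams) (i : ι P), n P i + 2 < (F.P P.K).sitesPerDir (k P i))
    (hbox : ∀ (P : B12.RunParams) (i : ι P), pts (k P i) (Λ P i) = (castSite '' Set.Icc (lo P i) (hi P i) : Set (Site (F.P P.K) (k P i))))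
    (hZ : ∀ (P : B12.RunParams) (i : ι P), (boxPlaqs (lo P i - 1) (hi P i + 1) : Set (Plaq (F.P P.K) (k P i))) ⊆ plaqsInside (pts (k P i) (Z P i)))
    (hTG0 : ∀ (P : B12.RunParams) (i : ι P), T P i = (box (fun κ => (hi P i κ - lo P i κ + 1).toNat) (lo P i)).image fun x =>
      (⟨castSite (x - unitVec ⟨0, h0 P⟩), ⟨0, h0 P⟩⟩ : PBond (F.P P.K) (k P i)))
    (hN5 : ∀ (P : B12.RunParams) (i : ι P) κ, ((hi P i κ - lo P i κ + 1).toNat : ℤ) + 5 < (F.P P.K).sitesPerDir (k P i))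
    (Kb : ∀ P : B12.RunParams, ι P → ℕ)
    (hK1 : ∀ (P : B12.RunParams) (i : ι P), 1 ≤ Kb P i)
    (hKn : ∀ (P : B12.RunParams) (i : ι P) κ, (hi P i κ - lo P i κ + 1).toNat ≤ Kb P i)
    (ext : ∀ (P : B12.RunParams) (i : ι P), GaugeField (F.P P.K) (k P i) SU2 → GaugeField (F.P P.K) (k P i) SU2)
    (hext : ∀ (P : B12.RunParams) (i : ι P) Vk, ext P i Vk = extend (pts (k P i) (Λ P i)) (shellGauge Vk (lo P i) (hi P i)) Vk)
    (hlohi : ∀ (P : B12.RunParams) (i : ι P), lo P i ≤ hi P i)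
    (LO HI : ∀ P : B12.RunParams, ι P → Fin (F.P P.K).d → ℤ)
    (hLO : ∀ (P : B12.RunParams) (i : ι P), LO P i ≤ lo P i - 1)
    (hHI : ∀ (P : B12.RunParams) (i : ι P), hi P i + 1 ≤ HI P i)
    (n' : ∀ P : B12.RunParams, ι P → ℕ)
    (hn' : ∀ (P : B12.RunParams) (i : ι P) κ, HI P i κ ≤ LO P i κ + n' P i)
    (hn'N : ∀ (P : B12.RunParams) (i : ι P), n' P i < (F.P P.K).sitesPerDir (k P i))
    (hR' : ∀ (P : B12.RunParams) (i : ι P), (boxPlaqs (LO P i) (HI P i) : Set (Plaq (F.P P.K) (k P i))) ⊆ plaqsInside (pts (k P i) (Z P i)))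
    {γ₈ bx : B12.RunParams → ℝ}
    (hγ : ∀ P : B12.RunParams, 0 < γ₈ P)
    (hbx : ∀ P : B12.RunParams, 0 ≤ bx P)
    (hbxM : ∀ (P : B12.RunParams) (i : ι P), 12 * ((F.P P.K).d : ℝ) * ((n P i : ℝ) + 2) ^ 2 ≤ bx P * (M P i) ^ 2)
    (hM : ∀ (P : B12.RunParams) (i : ι P), 1 ≤ (M P i))
    (W : ∀ P : B12.RunParams, ι P → Finset (Plaq (F.P P.K) 0))
    (hWbox : ∀ (P : B12.RunParams) (i : ι P), ∀ q : Plaq (F.P P.K) 0, q.src ∈ ((box (fun κ => (F.P P.K).L ^ (k P i) * ((hi P i κ - lo P i κ + 1).toNat + 3 + 1) - 1) (fun κ => ((F.P P.K).L : ℤ) ^ (k P i) * (lo P i κ - 2))).image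
        (fun z => (castSite z : Site (F.P P.K) 0))) → q ∈ W P i)
    (c : ∀ P : B12.RunParams, ι P → ℕ)
    (hkc : ∀ (P : B12.RunParams) (i : ι P), k P i + c P i ≤ (F.P P.K).m + (F.P P.K).K)
    (hc : ∀ (P : B12.RunParams) (i : ι P), 4 * (F.P P.K).d + (3 * ((F.P P.K).d * (((F.P P.K).L - 1) / 2)) + 5) + 3 < 2 * (F.P P.K).L ^ c P i)
    (X : ∀ P : B12.RunParams, ι P → Set (Site (F.P P.K) 0))
    (D₀ : ∀ P : B12.RunParams, ι P → ℕ)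
    (hBox : ∀ (P : B12.RunParams) (i : ι P), ∀ x ∈ X P i, ∀ w : List (Letter (F.P P.K).d),
      w.length ≤ (∑ i' ∈ Finset.range (k P i + 1), ((F.P P.K).d * (((F.P P.K).L ^ i' - 1) / 2) + 1)) + (3 * ((F.P P.K).d * (((F.P P.K).L - 1) / 2)) + 5) * (F.P P.K).L ^ k P i + (F.P P.K).L ^ k P i →
      ∀ μ : Fin (F.P P.K).d, (⟨B14.Eq22Determines.blockIter (k P i) (walkEnd x w), μ⟩ : PBond (F.P P.K) (k P i)) ∈ (boxBonds (LO P i) (HI P i) : Set (PBond (F.P P.K) (k P i))))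
    (hWX : ∀ (P : B12.RunParams) (i : ι P), ∀ p ∈ W P i, p.src ∈ X P i ∧ p.src.shift p.μ ∈ X P i ∧ p.src.shift p.ν ∈ X P i ∧ (p.src.shift p.μ).shift p.ν ∈ X P i ∧ (p.src.shift p.ν).shift p.μ ∈ X P i)
    (hfeedsX : ∀ (P : B12.RunParams) (i : ι P) (ν' : Fin (F.P P.K).d), ∀ z ∈ box (fun κ => (hi P i κ - lo P i κ + 1).toNat + 3) (fun κ => lo P i κ - 2), ∀ b₀ : PBond (F.P P.K) 0,
      (b₀ ∈ feeds (k P i) (⟨(castSite z : Site (F.P P.K) (k P i)), ⟨0, h0 P⟩⟩ : PBond (F.P P.K) (k P i)) ∨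
        b₀ ∈ feeds (k P i) (⟨((castSite z : Site (F.P P.K) (k P i))).shift ⟨0, h0 P⟩, ν'⟩ : PBond (F.P P.K) (k P i)) ∨
        b₀ ∈ feeds (k P i) (⟨((castSite z : Site (F.P P.K) (k P i))).shift ν', ⟨0, h0 P⟩⟩ : PBond (F.P P.K) (k P i)) ∨
        b₀ ∈ feeds (k P i) (⟨(castSite z : Site (F.P P.K) (k P i)), ν'⟩ : PBond (F.P P.K) (k P i))) → b₀.src ∈ X P i ∧ b₀.tgt ∈ X P i)
    {cE cA : B12.RunParams → ℝ}
    (hcE0 : ∀ P : B12.RunParams, 0 ≤ cE P)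
    (hcE : ∀ (P : B12.RunParams) (i : ι P), 12 * ((F.P P.K).d : ℝ) * ((n P i : ℝ) + 2) ^ 2 ≤ cE P)
    (hγle : ∀ (P : B12.RunParams) (i : ι P), γ₈ P / (M P i) ^ 5 ≤ 1 / 2 / (2 * (3 * (Kb P i : ℝ) ^ 2 + 2 * (Kb P i : ℝ) ^ 4)))
    (hZblk : ∀ (P : B12.RunParams) (i : ι P), IsBlockUnion (k P i) (Z P i))
    (hB₃ : 0 < B₃)
    (h15 : VariationalThm1RegSepCoP7M F 2 B₃ a₀ a₁')
    -- THE (J0′) HEAD's SKELETON ROWS AT εreg-BLIND NUMERICS `ν₀` (the head of record ✓p740879 is instantiated at `ν₀`; `Θ.ν` is pinned to `ν₀` off the class threshold below)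
    (ν₀ : Node00.Stage7Numerics)
    (hdiv₀ : ∀ (P : B12.RunParams) (i : ι P), side (F.P P.K).L ν₀.M₁ (k P i) ∣ (F.P P.K).sitesPerDir 0)
    (hfloor₀ : ∀ P : B12.RunParams, ((F.P P.K).d + 14) * (F.P P.K).L ≤ ν₀.M₁)
    (hMrad₀ : ∀ P : B12.RunParams, (4 * (F.P P.K).d + (3 * ((F.P P.K).d * (((F.P P.K).L - 1) / 2)) + 5)) * (F.P P.K).L ^ 2 + 2 * (F.P P.K).d * (F.P P.K).L + 12 ≤ ν₀.M₁)
    (hM₁₀ : ∀ P : B12.RunParams, (((F.P P.K).d + 4) * (F.P P.K).L + 6) * (F.P P.K).L ^ 2 ≤ ν₀.M₁)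
    -- the BOX SCOPE row of the head (every `k`-bond inside `Z^{(k)}` is a bond of the region box)
    (hscope : ∀ (P : B12.RunParams) (i : ι P), {e : PBond (F.P P.K) (k P i) | e.src ∈ pts (k P i) (Z P i) ∧ e.tgt ∈ pts (k P i) (Z P i)} ⊆ boxBonds (LO P i) (HI P i))
    -- the analytic family's bound scale (`𝓐₀ P i := 4·𝓐₁`)
    (𝓐₁ : ℝ) (h𝓐₁ : 1 < 𝓐₁)
    -- [15] THEOREM 1, EXISTENCE ∕ UNIQUENESS — the lane's floor-free NAMED fact (dag-n12-c g29 ✓p740853); «INHABITED BY»: OPEN (no producer; N07 ∕ NODE-00 obligation)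
    (h15EU : B11Thm1ExistsUniqueCoP7M.VariationalThm1EUSepCoP7M F 2 B₃ a₀ a₁') :
    -- THE THREE THRESHOLDS of the (J0′) head, announced from (ν₀, P.K, Z P i, k P i, the two [15] names) BEFORE Θ ∕ the class threshold ∕ the data budget (U4-existential, instance-dependent)
    ∃ ρJ εW δ₀ : ∀ P : B12.RunParams, ι P → ℝ, (∀ P i, 0 < ρJ P i) ∧ (∀ P i, 0 < εW P i) ∧ (∀ P i, 0 < δ₀ P i) ∧
    -- THE NINE LETTER CONSTANTS of the chart half (`C ρ Kτ ρτ ρ5`), the (P4)′ row (`εH B₁`), the small-below ∕ curvature letters (`ρ6 M₂`) — functions of `(P.K, k P)`, from the uniform producers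
    ∃ C ρ Kτ ρτ ρ5 εH B₁ ρ6 M₂ : ∀ P : B12.RunParams, ι P → ℝ, (∀ P i, 0 ≤ C P i) ∧ (∀ P i, 0 < ρ P i) ∧ (∀ P i, 0 ≤ Kτ P i) ∧ (∀ P i, 0 < ρτ P i) ∧ (∀ P i, 0 < ρ5 P i) ∧
      (∀ P i, 0 < εH P i) ∧ (∀ P i, 0 ≤ B₁ P i) ∧ (∀ P i, 0 < ρ6 P i) ∧ (∀ P i, 0 ≤ M₂ P i) ∧
    ∀ (Θ : Stage13Params F 2) (lam : ResidW F 2), { ν₀ with εreg := Θ.ν.εreg } = Θ.ν →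
      (Θ.HasResidualsOfRecord F 2) →
      (∀ P : B12.RunParams, lam.kSel P < P.K → lam.D1100 P
      = rPrimeDataOfSel (reprTOfRecord₁₃ F 2 (Θ.liveRepin₁₃ F 2) P (lam.kSel P))
          ((Θ.liveRepin₁₃ F 2).ppSel P (gOfRecord₁₃ F 2 (Θ.liveRepin₁₃ F 2) P) (lam.kSel P + 1))
          (fibOfSeq F (Θ.liveRepin₁₃ F 2).ν (Θ.liveRepin₁₃ F 2).τ9 P (gOfRecord₁₃ F 2 (Θ.liveRepin₁₃ F 2) P) (lam.kSel P + 1))) →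
      (∀ P : B12.RunParams, lam.kSel P < P.K → ∀ s, LiveSeq F 2 Θ.ν Θ.τ9 P (gOfRecord₁₃ F 2 (Θ.liveRepin₁₃ F 2) P) (lam.kSel P + 1)
        (slotsTOfRecord F 2 Θ.ν Θ.τ9 (EOfRecord₁₃ F 2 (Θ.liveRepin₁₃ F 2)) (wOfRecord₉ F 2 (Θ.liveRepin₁₃ F 2).toStage9Params)
          (Θ.liveRepin₁₃ F 2).ppSel P (gOfRecord₁₃ F 2 (Θ.liveRepin₁₃ F 2) P) (lam.kSel P + 1)) s →
      0 < ∫ V, rterm (reprTOfRecord₁₃ F 2 (Θ.liveRepin₁₃ F 2) P (lam.kSel P)) s V ∂(fieldMeasure (F.P P.K) (lam.kSel P + 1) (SU 2))) →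
      (∀ P : B12.RunParams, lam.kSel P < P.K → ∀ U, new189 (lam.D189 P) U → ∀ i, (lam.D189 P).h ≤ i → i ≤ (lam.D189 P).k →
      ∀ q ∈ plaqsOf (dom (lam.D189 P) i),
        Ineq180 ((lam.D189 P).dev0 U q) ((lam.D189 P).ε (lam.D189 P).k) (lam.D189 P).η (lam.D189 P).B₃ (lam.D189 P).B₅ (lam.D189 P).M (lam.D189 P).δ
          ((lam.D189 P).dist q) (lam.D189 P).O1) →
      (∀ P : B12.RunParams, lam.kSel P < P.K → Claim189 (new189 (lam.D189 P)) (chiPP (lam.D189 P))) →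
      (∀ (P : B12.RunParams) (i : ι P), ∀ (ν' : Fin (F.P P.K).d), ∀ z ∈ box (fun κ => (hi P i κ - lo P i κ + 1).toNat + 3) (fun κ => lo P i κ - 2),
      (castSite z : Site (F.P P.K) (k P i)) ∈ pts (k P i) (maxDomT Θ.ν.M₁ (Z P i) (k P i)) ∧
        (castSite z : Site (F.P P.K) (k P i)).shift ⟨0, h0 P⟩ ∈ pts (k P i) (maxDomT Θ.ν.M₁ (Z P i) (k P i)) ∧
        (castSite z : Site (F.P P.K) (k P i)).shift ν' ∈ pts (k P i) (maxDomT Θ.ν.M₁ (Z P i) (k P i))) →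
      (∀ P : B12.RunParams, (143 * (((((F.P P.K).d + 4 : ℕ) : ℝ)) ^ 2 / 4) ^ 2) * (Θ.ν.εreg * (F.P P.K).L ^ 2) ≤ 1 / 3) →
      (∀ P : B12.RunParams, 2 * (Θ.ν.εreg * (F.P P.K).L ^ 2) ≤ 2 * deltaSU (Fin 2) / ((((F.P P.K).d + 4) * (F.P P.K).L : ℕ) : ℝ) ^ 2) →
      (∀ P : B12.RunParams, (((((F.P P.K).d + 2) * (F.P P.K).L : ℕ) : ℝ) ^ 2 / 4) * (2 * (Θ.ν.εreg * (F.P P.K).L ^ 2)) < deltaSU (Fin 2)) →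
      (∀ (P : B12.RunParams) (i : ι P), ∀ x ∈ X P i, ∃ x₀ ∈ maxDomT Θ.ν.M₁ (Z P i) (k P i), ∃ w₀ : List (Letter (F.P P.K).d), w₀.length ≤ D₀ P i ∧ walkEnd x₀ w₀ = x) →
      (∀ (P : B12.RunParams) (i : ι P), D₀ P i + 3 * (∑ i' ∈ Finset.range (k P i + 1), ((F.P P.K).d * (((F.P P.K).L ^ i' - 1) / 2) + 1)) + ((3 * ((F.P P.K).d * (((F.P P.K).L - 1) / 2)) + 5) + 5) * (F.P P.K).L ^ k P i +
      (((F.P P.K).d + 4) * (F.P P.K).L + 2) * (∑ l ∈ Finset.Ico 0 (k P i), (F.P P.K).L ^ l) + 4 ≤ (F.P P.K).L ^ (k P i - 1) * Θ.ν.M₁) →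
      (∀ P : B12.RunParams, 4 * (F.P P.K).L ≤ Θ.ν.M₁) →
      (∀ (P : B12.RunParams) (i : ι P) (y : Site (F.P P.K) 0), B14.Eq22Determines.blockIter (k P i) y ∈ (castSite '' Set.Icc (lo P i - 1) (hi P i + 1) : Set (Site (F.P P.K) (k P i))) → y ∈ maxDomT Θ.ν.M₁ (Z P i) 1) →
      (∀ (P : B12.RunParams) (i : ι P), side (F.P P.K).L Θ.ν.M₁ (k P i) ∣ (F.P P.K).sitesPerDir 0) →
      (∀ (P : B12.RunParams) (i : ι P), 1 / 2 * (B₃ * (cE P + 1) * (F.P P.K).eta 1 ^ 2) ^ 2 * (Nat.card {q : Plaq (F.P P.K) 0 // q ∈ plaqsOf (maxDomT Θ.ν.M₁ (Z P i) 1)} : ℝ) ≤ cA P) →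
      (2 ≤ Θ.ν.M₁) →
      (0 < Θ.ν.εreg) →
      (Θ.ν.εreg ≤ a₀) →
      -- THE GUARD CAP `eG` and the cap-level datum tolerance `ρnG` with the head's rows at the cap (all upper bounds on `eG`, `ρnG`, `Θ.ν.εreg`)
      ∀ (eG ρnG : ∀ P : B12.RunParams, ι P → ℝ), (∀ (P : B12.RunParams) (i : ι P), 0 < eG P i) →
      (∀ (P : B12.RunParams) (i : ι P), 6 * ((((F.P P.K).d - 1 : ℕ)) : ℝ) * (F.P P.K).L ^ (k P i) * (2 * ((cE P + 1) * eG P i)) ≤ ρJ P i) →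
      (∀ (P : B12.RunParams) (i : ι P), 12 * ((((F.P P.K).d - 1 : ℕ)) : ℝ) * (F.P P.K).L * Θ.ν.εreg ≤ ρJ P i) →
      (∀ (P : B12.RunParams) (i : ι P), Θ.ν.εreg ≤ εW P i) →
      (∀ P : B12.RunParams, (143 * (((((F.P P.K).d + 4 : ℕ) : ℝ)) ^ 2 / 4) ^ 2) * (2 * ((F.P P.K).L : ℝ) ^ 2 * Θ.ν.εreg) ≤ 1 / 3) →
      (∀ P : B12.RunParams, 2 * (2 * ((F.P P.K).L : ℝ) ^ 2 * Θ.ν.εreg) ≤ 2 * deltaSU (Fin 2) / ((((F.P P.K).d + 4) * (F.P P.K).L : ℕ) : ℝ) ^ 2) →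
      (∀ (P : B12.RunParams) (i : ι P), (cE P + 1) * (2 * eG P i) ≤ a₁' ∧ B₃ * ((cE P + 1) * (2 * eG P i)) ≤ Θ.ν.εreg) →
      (Θ.ν.εreg < a₀) →
      (∀ (P : B12.RunParams) (i : ι P), 0 ≤ ρnG P i) →
      (∀ (P : B12.RunParams) (i : ι P), max (ρnG P i) ((((2 * (∑ i' ∈ Finset.range (k P i + 1), ((F.P P.K).d * (((F.P P.K).L ^ i' - 1) / 2) + 1)) + 1 +
                  (3 * ((F.P P.K).d * (((F.P P.K).L - 1) / 2)) + 5) * (F.P P.K).L ^ (k P i) : ℕ) : ℝ)) ^ 2 / 4 * (Θ.ν.εreg * (F.P P.K).eta 0 ^ 2) +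
                ((3 * ((F.P P.K).d * (((F.P P.K).L - 1) / 2)) + 5 : ℕ) : ℝ) * (6 * ((((((F.P P.K).d + 2) * (F.P P.K).L : ℕ) : ℝ) ^ 2 / 4) * (2 * (Θ.ν.εreg * (F.P P.K).L ^ 2))) * ∑ i' ∈ Finset.range (k P i), ((F.P P.K).L : ℝ) ^ i') + ((3 * ((F.P P.K).d * (((F.P P.K).L - 1) / 2)) + 5 : ℕ) : ℝ) * ρnG P i) ≤ δ₀ P i) →
      (∀ (P : B12.RunParams) (i : ι P), (((F.P P.K).d : ℝ) * n' P i + 1) * ((((F.P P.K).d - 1 : ℕ) : ℝ) * n' P i * ((12 * (F.P P.K).d * (n P i + 2) ^ 2 + 1) * eG P i) + 3 * (F.P P.K).d * (n P i + 2) ^ 2 * eG P i) ≤ ρnG P i) →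
      -- THE (J0′) RADIUS, announced BEFORE the data budget `eR`
      ∃ R : ∀ P : B12.RunParams, ι P → ℝ, (∀ P i, 0 < R P i) ∧
      ∀ (eR : ∀ P : B12.RunParams, ι P → ℝ), (∀ (P : B12.RunParams) (i : ι P), 0 < eR P i) → (∀ (P : B12.RunParams) (i : ι P), eR P i ≤ eG P i) →
      ∀ (ρn : ∀ P : B12.RunParams, ι P → ℝ),
      (∀ (P : B12.RunParams) (i : ι P), (((F.P P.K).d : ℝ) * n' P i + 1) * ((((F.P P.K).d - 1 : ℕ) : ℝ) * n' P i * ((12 * (F.P P.K).d * (n P i + 2) ^ 2 + 1) * eR P i)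
      + 3 * (F.P P.K).d * (n P i + 2) ^ 2 * eR P i) ≤ ρn P i) →
      ∀ (cJ : B12.RunParams → ℝ), (∀ P : B12.RunParams, 0 ≤ cJ P) →
      (∀ (P : B12.RunParams) (i : ι P), (cE P + 1) * (2 * eR P i) ≤ a₁' ∧ B₃ * ((cE P + 1) * (2 * eR P i)) ≤ Θ.ν.εreg) →
      (∀ (P : B12.RunParams) (i : ι P), 6 * ((((F.P P.K).d - 1 : ℕ)) : ℝ) * (F.P P.K).L * (2 * B₃ * (cE P + 1) * eR P i) ≤ ρ5 P i) →
      (∀ (P : B12.RunParams) (i : ι P), 6 * ((((F.P P.K).d - 1 : ℕ)) : ℝ) * (F.P P.K).L * (2 * B₃ * (cE P + 1) * eR P i) ≤ ρ6 P i) →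
      (∀ (P : B12.RunParams) (i : ι P), 2 * cA P * eR P i / R P i + 2 * ((Nat.card {q : Plaq (F.P P.K) 0 // q ∈ plaqsOf (maxDomT Θ.ν.M₁ (Z P i) 1)} : ℝ) * (1 + 8 * (4 * 𝓐₁) ^ 4)) / (R P i * eR P i) ≤ cJ P) →

    ∀ δ : ∀ P : B12.RunParams, ι P → ℝ, (∀ P i, 0 < δ P i) →
      -- the endpoint's EXPLICIT THRESHOLD per run (every quantity a displayed binder or a count of the run's instance — no `∃ δ₀`), then its TOLERANCE rows at `δ P i`
      (∀ (P : B12.RunParams) (i : ι P), δ P i ≤ min (min (min (ρ P i) (ρτ P i) / 2)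
        (min 1 (1 / 2 / (2 * (3 * (Kb P i : ℝ) ^ 2 + 2 * (Kb P i : ℝ) ^ 4)) /
          (max ((32 * (((F.P P.K).d : ℝ) - 1) + 8 * (((F.P P.K).d : ℝ) - 1) + (2 * (((F.P P.K).d : ℝ) - 1) * B₁ P i * (((∑ j ∈ Finset.range (k P i + 1), (2 * (F.P P.K).d) ^ j : ℕ) : ℝ) * M₂ P i))) * (12 * (4 * 𝓐₁) / R P i * Real.sqrt (Nat.card {b : PBond (F.P P.K) 0 // b.src ∈ maxDomT Θ.ν.M₁ (Z P i) 1})) ^ 2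
            + (8 * (((F.P P.K).d : ℝ) + 1) * (2 * (Kτ P i + 1)) + 8 * ((F.P P.K).d : ℝ) * (((box (fun κ => (hi P i κ - lo P i κ + 1).toNat + 3) (fun κ => lo P i κ - 2)).image (fun z => (castSite z : Site (F.P P.K) (k P i)))).card : ℝ) * (C P i * (12 * (4 * 𝓐₁) / R P i * Real.sqrt (Nat.card {b : PBond (F.P P.K) 0 // b.src ∈ maxDomT Θ.ν.M₁ (Z P i) 1}))) ^ 2)) 0 + 1)))) (εH P i)) →
      ∀ (hfloor : ∀ (P : B12.RunParams) (i : ι P), ((((4 * (F.P P.K).d + (3 * ((F.P P.K).d * (((F.P P.K).L - 1) / 2)) + 5) + 3 : ℕ) : ℝ)) ^ 2 * ((F.P P.K).L : ℝ) ^ 2 / 4 + ((3 * ((F.P P.K).d * (((F.P P.K).L - 1) / 2)) + 5 : ℕ) : ℝ) * (24 * (((((F.P P.K).d + 2) * (F.P P.K).L : ℕ) : ℝ) ^ 2 / 4))) * (2 * B₃ * (cE P + 1) * eR P i) + ((3 * ((F.P P.K).d * (((F.P P.K).L - 1) / 2)) + 5 : ℕ) : ℝ) * ρn P i ≤ δ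 P i),
      ∃ areg : ∀ P : B12.RunParams, ι P → ℝ, (∀ P i, 0 < areg P i) ∧
        ∀ P : B12.RunParams, lam.kSel P < P.K →
          B15Leaf (WOfRecord₁₃ F 2 (Θ.liveRepin₁₃ F 2)
            { lam with LF := fun P => lfVarOn su2Chart fun i => InstOn.std (Node00.bgMSCoPOfRecord F 2 Θ.ν P.K (k P i) (maxDomT Θ.ν.M₁ (Z P i))) Θ.ν.M₁ (Z P i) (Λ P i) (k P i) (M P i) (areg P i) (anExt (pts (k P i) (Λ P i)) (T P i) (fun177std (Node00.bgMSCoPOfRecord F 2 Θ.ν P.K (k P i) (maxDomT Θ.ν.M₁ (Z P i))) Θ.ν.M₁ (Z P i) (k P i)) (ext P i) (min (1 / 2) (min (R P i / 8) (γ₈ P / (M P i) ^ 5 * (R P i / 2) ^ 2 / (48 * (4 * ((Nat.card {q : Plaq (F.P P.K) 0 // q ∈ plaqsOf (maxDomT Θ.ν.M₁ (Z P i) 1)} : ℝ) * (1 + 8 * (4 * 𝓐₁) ^ 4)) / R P i + 1)))))) } P) := by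
  -- §A  the thresholds from the head of record at `ν₀`, per instance
  have hk1' : ∀ (P : B12.RunParams) (i : ι P), 1 ≤ k P i := fun P i => Nat.succ_le_of_lt (hk0 P i)
  choose ρJ εW hρJ hεW δ₀ hδ₀ hbody using fun (P : B12.RunParams) (i : ι P) =>
    exists_R_hMinRow_of_variationalThm1NamedFacts_alongOrbit_onZ_ofRecord (F := F) ν₀ P.K (hd3 P) (Z P i) (hk1 P i) (hk1' P i) (hdiv₀ P i) (hfloor₀ P) (hZblk P i)
      (hkc P i) (hc P i) (hMrad₀ P) (hM₁₀ P) h15 h15EU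
  -- §A′ the four letter families from the hypothesis-free uniform producers, per run (constants = functions of `(P.K, k P)`)
  have hkle : ∀ (P : B12.RunParams) (i : ι P), k P i ≤ (F.P P.K).m + (F.P P.K).K := fun P i => Nat.le_of_succ_le (hk1 P i)
  choose C ρ Kτ ρτ ρ5 hC hρ hKτ hρτ hρ5 hhalf using fun P : B12.RunParams => exists_hWD_chartHalf_of_class_uniform_rowl1_family (F := F) P.K (h0 P) (k P) (hk0 P) (hkle P)
  choose εH hεH B₁ hB1 hrow using fun P : B12.RunParams => exists_rowPreimageProxiesLetter_family_uniformB (F := F) P.K (k P) (hk1 P)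
  choose ρ6 M₂ hρ6 hM₂0 hsbU hcurv using fun P : B12.RunParams => exists_curvatureLetters_family (F := F) P.K (k P)
  refine ⟨ρJ, εW, δ₀, hρJ, hεW, hδ₀, C, ρ, Kτ, ρτ, ρ5, εH, B₁, ρ6, M₂, hC, hρ, hKτ, hρτ, hρ5, hεH, hB1, hρ6, hM₂0, ?_⟩
  intro Θ lam hν₀ hres hpin hmassLive h180 h189 hΩw hα3 hα2 haN hXΩ hfit hM4 hZ1 hdiv hcA hM2 hεreg ha₀ eG ρnG heG hρJ1 hρJ2 hεWr hα3h hα2h haG ha₀s hρnG0 hT hnormG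
  have hM₁ : ν₀.M₁ = Θ.ν.M₁ := by rw [← hν₀]
  -- §B  the radius at the cap, per instance
  choose R hR hMinG using fun (P : B12.RunParams) (i : ι P) =>
    hbody P i (Λ P i) (lo P i) (hi P i) (eG P i) (heG P i) (n P i) (hn P i) (hN5 P i) (hlohi P i) (hbox P i) (hZ P i)
      (LO P i) (HI P i) (n' P i) (hLO P i) (hHI P i) (hn' P i) (hn'N P i) (hR' P i) (hscope P i) (hcE P i) (hρJ1 P i) (ext P i) (hext P i)
      h𝓐₁ Θ.ν.εreg hεreg (hρJ2 P i) (hεWr P i) (hα3h P) (hα2h P) (haG P i).1 (haG P i).2 ha₀s le_rfl (hρnG0 P i) (hT P i) (hnormG P i)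
  refine ⟨R, hR, ?_⟩
  intro eR heR heRG ρn hρn cJ hcJ heRa hερ hερ6 hcJ' δ hδ hδle hfloor
  -- §C  (J0′) at the data budget `eR ≤ eG` by RESTRICTING the guard; numerics pinned to `Θ.ν`
  have hMin : ∀ (P : B12.RunParams) (i : ι P) (Vk : GaugeField (F.P P.K) (k P i) SU2), PlaqSmallOn (plaqsInside (pts (k P i) (Z P i ∩ (Λ P i)ᶜ))) (eR P i) Vk →
      ∃ Ũ : VecField (F.P P.K) (k P i) (EuclideanSpace ℂ (Fin 3)) × VecField (F.P P.K) (k P i) (EuclideanSpace ℂ (Fin 3)) →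
          PBond (F.P P.K) 0 → Matrix (Fin 2) (Fin 2) ℂ,
        (∀ b a c, DifferentiableOn ℂ (fun z => Ũ z b a c) (ball 0 (R P i))) ∧
        (∀ z ∈ ball (0 : VecField (F.P P.K) (k P i) (EuclideanSpace ℂ (Fin 3)) × VecField (F.P P.K) (k P i) (EuclideanSpace ℂ (Fin 3))) (R P i),
          ∀ b a c, ‖Ũ z b a c‖ ≤ 4 * 𝓐₁) ∧
        ∀ p B' : VecField (F.P P.K) (k P i) E3, ‖p‖ < R P i → ‖B'‖ < R P i → ∃ U' : GaugeField (F.P P.K) 0 SU2,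
          (∀ b, Ũ (cplxVec p, cplxVec B') b = ((U' b : SU2) : Matrix (Fin 2) (Fin 2) ℂ)) ∧
            IsMinimizer (Node00.avOfRecord F 2 P.K) (Node00.regMSCoPOfRecord F 2 Θ.ν P.K (k P i) (maxDomT Θ.ν.M₁ (Z P i))) (Bj Θ.ν.M₁ (Z P i) (k P i))
              (avgFamily (Node00.avOfRecord F 2 P.K) (qsstarGIter0 (k P i) (expMul su2Chart B' (ext P i (expMul su2Chart p Vk))))) U' := by
    intro P i Vk hV
    have h := hMinG P i Vk (plaqSmallOn_of_le (heRG P i) hV)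
    rw [hν₀, hM₁] at h
    exact h
  -- §D  the two conversion letters DISCHARGED from the lane's kit ([15] (8) via `h15` + the datum's (7); dag-n12-c g31 ✓p746805)
  have hc1 : ∀ P : B12.RunParams, 0 ≤ cE P + 1 := fun P => by linarith [hcE0 P]
  have heRa1 : ∀ (P : B12.RunParams) (i : ι P), (cE P + 1) * eR P i ≤ a₁' := fun P i => by
    have h := (heRa P i).1; nlinarith [mul_nonneg (hc1 P) (heR P i).le]
  have heRa2 : ∀ (P : B12.RunParams) (i : ι P), 2 * ((cE P + 1) * eR P i) ≤ a₁' := fun P i => by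
    have h := (heRa P i).1; linarith [show (cE P + 1) * (2 * eR P i) = 2 * ((cE P + 1) * eR P i) by ring]
  have heν : ∀ (P : B12.RunParams) (i : ι P), 2 * B₃ * (cE P + 1) * eR P i ≤ Θ.ν.εreg := fun P i => by
    have h := (heRa P i).2; linarith [show B₃ * ((cE P + 1) * (2 * eR P i)) = 2 * B₃ * (cE P + 1) * eR P i by ring]
  have he1 : ∀ (P : B12.RunParams) (i : ι P), B₃ * ((cE P + 1) * eR P i) ≤ 2 * B₃ * (cE P + 1) * eR P i := fun P i => by
    nlinarith [mul_nonneg hB₃.le (mul_nonneg (hc1 P) (heR P i).le)]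
  have he2 : ∀ (P : B12.RunParams) (i : ι P), B₃ * (2 * ((cE P + 1) * eR P i)) ≤ 2 * B₃ * (cE P + 1) * eR P i := fun P i => le_of_eq (by ring)
  have hKa : ∀ (P : B12.RunParams) (i : ι P) (Vk : GaugeField (F.P P.K) (k P i) SU2), PlaqSmallOn (plaqsInside (pts (k P i) (Z P i ∩ (Λ P i)ᶜ))) (eR P i) Vk →
      (∀ b ∈ (boxBonds (LO P i) (HI P i) : Set (PBond (F.P P.K) (k P i))), dist1 (ext P i Vk b) ≤ ρn P i) →
      ∀ U₀ : GaugeField (F.P P.K) 0 SU2,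
        IsMinimizer (Node00.avOfRecord F 2 P.K) (Node00.regMSCoPOfRecord F 2 Θ.ν P.K (k P i) (maxDomT Θ.ν.M₁ (Z P i))) (Bj Θ.ν.M₁ (Z P i) (k P i))
          (avgFamily (Node00.avOfRecord F 2 P.K) (qsstarGIter0 (k P i) (ext P i Vk))) U₀ →
        IsMinimizer (Node00.avOfRecord F 2 P.K) (Node00.regMSCoPOfRecord F 2 {Θ.ν with εreg := 2 * B₃ * (cE P + 1) * eR P i} P.K (k P i) (maxDomT Θ.ν.M₁ (Z P i))) (Bj Θ.ν.M₁ (Z P i) (k P i))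
          (avgFamily (Node00.avOfRecord F 2 P.K) (qsstarGIter0 (k P i) (ext P i Vk))) U₀ :=
    fun P i Vk hg _ U₀ hU₀ =>
      (isMinimizer_withEps_base_of_thm1TorusClass Θ.ν P.K (hd3 P) (Z P i) (Λ P i) (hk0 P i) (hkle P i) (lo P i) (hi P i) (n P i) (hn P i) (hlohi P i)
        (hbox P i) (hZ P i) (boxRow3_of_boxRow5 (hlohi P i) (hN5 P i)) (ext P i) (hext P i) (hZblk P i) hM2 (hdiv P i) (hcE P i)
        (thm1TorusClass_of_variationalThm1RegSepCoP7M Θ.ν P.K h15) (2 * B₃ * (cE P + 1) * eR P i) (eR P i) Vk (heR P i) (heRa1 P i) (he1 P i) (heν P i) ha₀ hg U₀ hU₀).2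
  have hKb : ∀ (P : B12.RunParams) (i : ι P) (Vk : GaugeField (F.P P.K) (k P i) SU2), PlaqSmallOn (plaqsInside (pts (k P i) (Z P i ∩ (Λ P i)ᶜ))) (eR P i) Vk →
      (∀ b ∈ (boxBonds (LO P i) (HI P i) : Set (PBond (F.P P.K) (k P i))), dist1 (ext P i Vk b) ≤ ρn P i) →
      ∃ r : ℝ, 0 < r ∧ ∀ Y : GaugeSlice (pts (k P i) (Λ P i)) (T P i) E3, ‖Y‖ < r → ∀ U : GaugeField (F.P P.K) 0 SU2,
        IsMinimizer (Node00.avOfRecord F 2 P.K) (Node00.regMSCoPOfRecord F 2 Θ.ν P.K (k P i) (maxDomT Θ.ν.M₁ (Z P i))) (Bj Θ.ν.M₁ (Z P i) (k P i))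
          (avgFamily (Node00.avOfRecord F 2 P.K) (qsstarGIter0 (k P i) (expMul su2Chart (ιA (pts (k P i) (Λ P i)) (T P i) Y) (ext P i Vk)))) U →
        IsMinimizer (Node00.avOfRecord F 2 P.K) (Node00.regMSCoPOfRecord F 2 {Θ.ν with εreg := 2 * B₃ * (cE P + 1) * eR P i} P.K (k P i) (maxDomT Θ.ν.M₁ (Z P i))) (Bj Θ.ν.M₁ (Z P i) (k P i))
          (avgFamily (Node00.avOfRecord F 2 P.K) (qsstarGIter0 (k P i) (expMul su2Chart (ιA (pts (k P i) (Λ P i)) (T P i) Y) (ext P i Vk)))) U :=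
    fun P i Vk hg _ => ⟨eR P i / 8, by have := heR P i; positivity, fun Y hY U hU =>
      (isMinimizer_withEps_of_norm_lt Θ.ν P.K (hd3 P) (Z P i) (Λ P i) (hk0 P i) (hkle P i) (lo P i) (hi P i) (n P i) (hn P i) (hlohi P i)
        (hbox P i) (hZ P i) (boxRow3_of_boxRow5 (hlohi P i) (hN5 P i)) (ext P i) (hext P i) (hZblk P i) hM2 (hdiv P i) (hcE P i)
        (thm1TorusClass_of_variationalThm1RegSepCoP7M Θ.ν P.K h15) (heR P i) (heRa2 P i) (he2 P i) (heν P i) ha₀ Vk hg (T P i) Y hY U hU).2⟩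
  exact exists_areg_pinLF_b15Leaf_WOfRecord₁₃_liveRepin₁₃_of_massLive_of_hasResiduals_of_variationalThm1RegSepCoP7M_atZSeqCoPRecord_windowDirectOfClassOnlyRowL1NearRadiusDatumScale Θ lam
    (hres := hres) (hpin := hpin) (hmassLive := hmassLive) (h180 := h180) (h189 := h189) (hd3 := hd3) (h0 := h0) (ι := ι) (B₃ := B₃) (a₀ := a₀) (a₁' := a₁') (Z := Z) (Λ := Λ) (k := k)
    (M := M) (hk0 := hk0) (hk1 := hk1) (eR := eR) (heR := heR) (T := T) (lo := lo) (hi := hi) (n := n) (hn := hn) (hN := hN) (hbox := hbox) (hZ := hZ) (hTG0 := hTG0) (hN5 := hN5) (Kb := Kb)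
    (hK1 := hK1) (hKn := hKn) (ext := ext) (hext := hext) (hlohi := hlohi) (LO := LO) (HI := HI) (hLO := hLO) (hHI := hHI) (n' := n') (hn' := hn') (hn'N := hn'N) (hR' := hR') (ρn := ρn)
    (hρn := hρn) (γ₈ := γ₈) (cJ := cJ) (bx := bx) (hγ := hγ) (hcJ := hcJ) (hbx := hbx) (hbxM := hbxM) (R := R) (𝓐₀ := fun _ _ => 4 * 𝓐₁) (hM := hM) (hR := hR)
    (h𝓐₀ := fun _ _ => by positivity) (hMin := hMin) (hΩw := hΩw) (W := W) (hWbox := hWbox) (c := c) (hkc := hkc) (hc := hc) (hα3 := hα3) (hα2 := hα2) (haN := haN) (X := X) (D₀ := D₀)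
    (hXΩ := hXΩ) (hfit := hfit) (hBox := hBox) (hWX := hWX) (hfeedsX := hfeedsX) (C := C) (ρ := ρ) (Kτ := Kτ) (ρτ := ρτ) (ρ5 := ρ5) (hρ := hρ) (hKτ := hKτ) (hρτ := hρτ) (hhalf := hhalf)
    (cE := cE) (cA := cA) (hcE0 := hcE0) (hcE := hcE) (heRa := heRa) (hM4 := hM4) (hερ := hερ) (εH := εH) (B₁ := B₁) (M₂ := M₂) (ρ6 := ρ6) (hB1 := hB1) (hM₂0 := hM₂0) (hHrow := fun P i Wd U₀ => hrow P Θ.ν hM2 (Z P) (hdiv P) i Wd U₀)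
    (hsbU := hsbU) (hcurv := hcurv) (hερ6 := hερ6) (hKa := hKa) (hKb := hKb) (hγle := hγle) (hZ1 := hZ1) (hZblk := hZblk) (hdiv := hdiv) (hcA := hcA) (hcJ' := hcJ') (hM2 := hM2)
    (hB₃ := hB₃) (hεreg := hεreg) (ha₀ := ha₀) (h15 := h15)
    δ hδ hδle hfloor

end Summit.QuantumFields.YangMills.BalabanUVNodes.N12AtRecord13Prop1KnitThm1WindowDirectDatumScaleLettersDischargedOfThm1NamedFactsOfRecord

end
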